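import Summits.Parity.GeneralizedHardyLittlewood.Theses.LZZCertificateReplay

/-!
# Route `LZZCertificateReplay` — the glue item of the LIGHT/HEAVY split of `ReplayedCertificates`

Item `ReplayedCertificatesGlue` (stmt-Parity-19298; split W-3 of `ReplayedCertificates`, director
2026-08-26T01:40Z, typed by theory g5): `LightRows → HeavyRows → ReplayedCertificates`, where
`LightRows = CertifiedRange (1/5) 23 400000 heavyList15` (every fundamental `23 < |D| ≤ 4·10⁵`
outside the heavy list carries a Lu–Zaman–Zhao Table-1 certificate), `HeavyRows = ∀ D ∈ heavyList15,
direct D = false → CertifiedAt (1/5) D` (the heavy discriminants not settled by mathematics are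
certified) and `ReplayedCertificates = theorem21 → NoExceptionalZeroUpTo 400000 (1/5)`. The proof is
the Literature lemma `noExceptionalZeroUpTo_of_light_heavy` (`NoRealZeroCertificateReplaySplit.lean`,
p419723): exceptions settled by the kernel base `noRealZeroUpTo_fiftyTwo` (conductors `≤ 52`) and the
Epstein class sum for odd conductors `≤ 163` (`LFunction_ne_zero_of_odd_quadratic_of_le_onehundredsixtythree`),
the rest by the bridge with exceptions and the printed Theorem 2.1. Nothing is computed here.
-/

namespace Summit.Parity.GeneralizedHardyLittlewood.Theorems

open Summit.Parity.GeneralizedHardyLittlewood.Theses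

/-- **Glue of the split** (item `ReplayedCertificatesGlue`): a certified LIGHT layer and a certified
HEAVY layer (minus the directly settled rows) give `ReplayedCertificates`, i.e.
`theorem21 → NoExceptionalZeroUpTo 400000 (1/5)`. Proof: `noExceptionalZeroUpTo_of_light_heavy`. -/
theorem replayedCertificatesGlue_holds : LZZCertificateReplay.ReplayedCertificatesGlue := by
  unfold LZZCertificateReplay.ReplayedCertificatesGlue LZZCertificateReplay.LightRows
    LZZCertificateReplay.HeavyRows LZZCertificateReplay.ReplayedCertificates
  intro hl hh h21
  exact Literature.NumberTheory.LFunctions.LuZamanZhao2026.Replay.noExceptionalZeroUpTo_of_light_heavy h21 hl hh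

end Summit.Parity.GeneralizedHardyLittlewood.Theorems
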